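import Summits.AtomisticToContinuum.Crystallization.Theorems.FrustratedLawDichotomyStrainedPatchHomExteriorRaySigned

/-!
# Strained patch, `(H)` hcp exterior certificate (architecture R3) — E3 KIT for the two numeric side hypotheses of the exterior leaf theorems: `U(ξ − ξ₀) ≠ 0` and the
# separation floor `ρ ≤ ‖U(ξ − ξ₀)‖` from ONE integer coordinate gap between the cell's ξ-box and the slab box (decomp-a2c hand 2, generation 39; structural #12; DEF-FREE)

`hver_exterior_of_curvChecks_uniformFloor` (p854094) / `…_signedFloor` (p854099) take `hΔ : U(ξ − ξ₀) ≠ 0` and a domination `… < ℓmin·‖U(ξ − ξ₀)‖`.  Both follow from the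
INTEGER data of the column: the slab box and the cell's ξ-box are disjoint on some ξ-coordinate with gap `g` (scaled), and `‖U − 1‖ ≤ 1/4`:

* (tree `…HomLatticeBox.norm_apply_ge_of_near_one`: `(3/4)‖v‖ ≤ ‖U v‖`); `apply_ne_zero_of_near_one`; private `abs_apply_le_norm` (`|v i| ≤ ‖v‖` on `E3`);
* `abs_sub_coord_ge_of_gap`: `|ξ i − c/SC| ≤ w/SC`, `|ξ₀ i − c₀/SC| ≤ w₀/SC`, integer gap `c₀ + w₀ + g ≤ c − w` or `c + w + g ≤ c₀ − w₀` ⟹ `g/SC ≤ |ξ i − ξ₀ i|`;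
* ★ `norm_U_sub_ge_of_gap`: then `(3/4)·(g/SC) ≤ ‖U(ξ − ξ₀)‖`, and ★ `U_sub_ne_zero_of_gap` (`0 < g`): `U(ξ − ξ₀) ≠ 0`;
* ★ `dom_of_gap`: `S + f₀ + r ≤ ℓmin·(3/4)·(g/SC)` with `0 ≤ ℓmin`, `0 < g` … packaged as the strict domination the leaf theorems want, from an integer-checkable premise.

0 sorry; no definitions; standard axioms.  `--supports stmt-AtomisticToContinuum-27623`.  [folklore]
-/

noncomputable section

open Set

namespace Summit.AtomisticToContinuum.Crystallization.Theorems.FrustratedLawDichotomyStrainedPatchHomExteriorRay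

open scoped BigOperators RealInnerProductSpace
open Literature.Analysis.ValidatedNumerics.Numerics
open Summit.AtomisticToContinuum.Crystallization.Theorems.ChargedEnergyGapNegative (E3)
open Summit.AtomisticToContinuum.Crystallization.Theorems.FrustratedLawDichotomyStrainedPatchHomLatticeBox (norm_apply_ge_of_near_one)

/-- `‖U − 1‖ ≤ 1/4` ⟹ `U` is injective: `v ≠ 0 ⟹ U v ≠ 0`. [folklore] -/
theorem apply_ne_zero_of_near_one {U : E3 →L[ℝ] E3} (hU : ‖U - 1‖ ≤ 1 / 4) {v : E3} (hv : v ≠ 0) : U v ≠ 0 := by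
  intro h
  have := norm_apply_ge_of_near_one hU v
  rw [h, norm_zero] at this
  have : ‖v‖ = 0 := by linarith [norm_nonneg v]
  exact hv (norm_eq_zero.1 this)

/-- A coordinate is bounded by the Euclidean norm. [folklore] (`private`: the same statement is `Literature.Barriers.FinalStateConjecture.abs_apply_le_norm_E3`, not in this
import closure.) -/
private theorem abs_apply_le_norm (v : E3) (i : Fin 3) : |v i| ≤ ‖v‖ := by
  have h := EuclideanSpace.norm_eq v
  rw [h]
  have : |v i| = Real.sqrt (‖v i‖ ^ 2) := by rw [Real.sqrt_sq (norm_nonneg _)]; rfl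
  rw [this]
  exact Real.sqrt_le_sqrt (Finset.single_le_sum (fun j _ => sq_nonneg ‖v j‖) (Finset.mem_univ i))

/-- ★ **INTEGER COORDINATE GAP ⟹ REAL SEPARATION**: `ξ i` in `[c − w, c + w]/SC`, `ξ₀ i` in `[c₀ − w₀, c₀ + w₀]/SC`, and the two integer intervals are `g` apart
(`c₀ + w₀ + g ≤ c − w` or `c + w + g ≤ c₀ − w₀`) ⟹ `g/SC ≤ |ξ i − ξ₀ i|`. [arithmetic] -/
theorem abs_sub_coord_ge_of_gap {x x₀ : ℝ} {c w c₀ w₀ g : ℤ} (hx : |x - (c : ℝ) / SC| ≤ (w : ℝ) / SC) (hx₀ : |x₀ - (c₀ : ℝ) / SC| ≤ (w₀ : ℝ) / SC)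
    (hgap : c₀ + w₀ + g ≤ c - w ∨ c + w + g ≤ c₀ - w₀) : (g : ℝ) / SC ≤ |x - x₀| := by
  have hS : (0 : ℝ) < SC := SC_pos
  rw [abs_sub_le_iff] at hx hx₀
  have hx1 := hx.1; have hx2 := hx.2; have hy1 := hx₀.1; have hy2 := hx₀.2
  rcases hgap with h | h
  · have h' : ((c₀ : ℝ) + w₀ + g) / SC ≤ ((c : ℝ) - w) / SC := by
      apply div_le_div_of_nonneg_right _ hS.le; exact_mod_cast h
    rw [add_div, add_div, sub_div] at h'
    rw [le_abs]
    left; linarith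
  · have h' : ((c : ℝ) + w + g) / SC ≤ ((c₀ : ℝ) - w₀) / SC := by
      apply div_le_div_of_nonneg_right _ hS.le; exact_mod_cast h
    rw [add_div, add_div, sub_div] at h'
    rw [le_abs]
    right; linarith

/-- ★ **THE SEPARATION FLOOR**: ξ in the slab box `(c, w)`, ξ₀ in the cell box `(c₀, w₀)`, an integer gap `g` on coordinate `i`, `‖U − 1‖ ≤ 1/4` ⟹
`(3/4)·(g/SC) ≤ ‖U(ξ − ξ₀)‖` (the `ρ` of the domination hypotheses). [folklore chaining] -/
theorem norm_U_sub_ge_of_gap {U : E3 →L[ℝ] E3} (hU : ‖U - 1‖ ≤ 1 / 4) {ξ ξ₀ : E3} {c w c₀ w₀ : (Fin 3 × Fin 3) ⊕ Fin 3 → ℤ} (i : Fin 3) {g : ℤ}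
    (hξ : ∀ j : Fin 3, |ξ j - (c (Sum.inr j) : ℝ) / SC| ≤ (w (Sum.inr j) : ℝ) / SC)
    (hξ₀ : ∀ j : Fin 3, |ξ₀ j - (c₀ (Sum.inr j) : ℝ) / SC| ≤ (w₀ (Sum.inr j) : ℝ) / SC)
    (hgap : c₀ (Sum.inr i) + w₀ (Sum.inr i) + g ≤ c (Sum.inr i) - w (Sum.inr i) ∨ c (Sum.inr i) + w (Sum.inr i) + g ≤ c₀ (Sum.inr i) - w₀ (Sum.inr i)) :
    3 / 4 * ((g : ℝ) / SC) ≤ ‖U (ξ - ξ₀)‖ := by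
  have h1 : (g : ℝ) / SC ≤ |(ξ - ξ₀) i| := by
    have := abs_sub_coord_ge_of_gap (hξ i) (hξ₀ i) hgap
    simpa only [PiLp.sub_apply] using this
  have h2 : |(ξ - ξ₀) i| ≤ ‖ξ - ξ₀‖ := abs_apply_le_norm _ _
  have h3 := norm_apply_ge_of_near_one hU (ξ - ξ₀)
  linarith

/-- ★ `U(ξ − ξ₀) ≠ 0` from a POSITIVE integer gap (the `hΔ` of the exterior leaf theorems). [folklore chaining] -/
theorem U_sub_ne_zero_of_gap {U : E3 →L[ℝ] E3} (hU : ‖U - 1‖ ≤ 1 / 4) {ξ ξ₀ : E3} {c w c₀ w₀ : (Fin 3 × Fin 3) ⊕ Fin 3 → ℤ} (i : Fin 3) {g : ℤ}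
    (hg : 0 < g)
    (hξ : ∀ j : Fin 3, |ξ j - (c (Sum.inr j) : ℝ) / SC| ≤ (w (Sum.inr j) : ℝ) / SC)
    (hξ₀ : ∀ j : Fin 3, |ξ₀ j - (c₀ (Sum.inr j) : ℝ) / SC| ≤ (w₀ (Sum.inr j) : ℝ) / SC)
    (hgap : c₀ (Sum.inr i) + w₀ (Sum.inr i) + g ≤ c (Sum.inr i) - w (Sum.inr i) ∨ c (Sum.inr i) + w (Sum.inr i) + g ≤ c₀ (Sum.inr i) - w₀ (Sum.inr i)) :
    U (ξ - ξ₀) ≠ 0 := by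
  have h := norm_U_sub_ge_of_gap hU i hξ hξ₀ hgap
  have hgpos : (0 : ℝ) < 3 / 4 * ((g : ℝ) / SC) := by
    have : (0 : ℝ) < (g : ℝ) := by exact_mod_cast hg
    have hS : (0 : ℝ) < SC := SC_pos
    positivity
  intro h0
  rw [h0, norm_zero] at h
  linarith

/-- ★ **DOMINATION FROM THE GAP**: if `K ≤ ℓmin·(3/4)·(g/SC)` fails strictly the other way, i.e. `K < ℓmin · (3/4 · (g/SC))` with `0 ≤ ℓmin`, then `K < ℓmin·‖U(ξ − ξ₀)‖` — the
`hdom` of the exterior leaf theorems from an inequality between constants (for the Bool: integers after clearing `SC`). [arithmetic] -/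
theorem dom_of_gap {U : E3 →L[ℝ] E3} (hU : ‖U - 1‖ ≤ 1 / 4) {ξ ξ₀ : E3} {c w c₀ w₀ : (Fin 3 × Fin 3) ⊕ Fin 3 → ℤ} (i : Fin 3) {g : ℤ}
    (hξ : ∀ j : Fin 3, |ξ j - (c (Sum.inr j) : ℝ) / SC| ≤ (w (Sum.inr j) : ℝ) / SC)
    (hξ₀ : ∀ j : Fin 3, |ξ₀ j - (c₀ (Sum.inr j) : ℝ) / SC| ≤ (w₀ (Sum.inr j) : ℝ) / SC)
    (hgap : c₀ (Sum.inr i) + w₀ (Sum.inr i) + g ≤ c (Sum.inr i) - w (Sum.inr i) ∨ c (Sum.inr i) + w (Sum.inr i) + g ≤ c₀ (Sum.inr i) - w₀ (Sum.inr i))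
    {K ℓmin : ℝ} (hℓ : 0 ≤ ℓmin) (hK : K < ℓmin * (3 / 4 * ((g : ℝ) / SC))) : K < ℓmin * ‖U (ξ - ξ₀)‖ :=
  hK.trans_le (mul_le_mul_of_nonneg_left (norm_U_sub_ge_of_gap hU i hξ hξ₀ hgap) hℓ)

end Summit.AtomisticToContinuum.Crystallization.Theorems.FrustratedLawDichotomyStrainedPatchHomExteriorRay

end
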